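import Literature.MathematicalPhysics.QuantumFieldTheory.Balaban1983to89.B16Ineq197RelGlue

/-!
# `Balaban1983to89.B16Ineq197XBudget` (v1) — the leaf `XBudget` (the PER-COMPONENT BUDGET of (1.93),
[Balaban1989LargeFieldII] p. 389) of the cell's typed (1.91) ⇒ (1.97) bookkeeping `…B16Ineq197.Polymer`, DISCHARGED by
ARITHMETIC over unit pv22's continuum model `…TreeLength` (tree cost `treeLen X_j + 2 ≤ #X_j + 1` by this lineage's
`B16Ineq197RelGlue.treeLen_add_two_le_card_add_one`) modulo a NAMED volume bound `#X_j ≤ V` and the explicit clause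
`(1+β)κ(V+1) + lam·βκ·V ≤ E`; the printed numbers (V = (100R)^d, E ≥ 2κ(100R)^d, β(1+lam) ≤ ½) as a corollary; a one-component
non-vacuity witness.  With this module EVERY leaf of `…B16Ineq197` has a kernel lattice-level sufficient condition modulo named
incidences (`Subadd193`: `…B16Ineq197RelGlue`; `Vol193`, `Anch194`: `…B16Ineq197RelCubes`; `Count196`: `…B16Count196Packing`;
`XBudget`: here).

CITATION HEADER (lean-in-tree rule 2026-08-18).  Source under audit (cell paper B16): T. Bałaban, *Large field
renormalization. II. Localization, exponentiation, and bounds for the 𝐑 operation*, Commun. Math. Phys. **122**, 355–392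
(1989) [Balaban1989LargeFieldII] (held `paper:balaban1989-cmp122-large-field-ii`; journal page = PDF page + 354); the
quotations below are read from the page renders `…1989-cmp122-large-field-II-p034/p035-x2.png` (pp. 388, 389) READ AS IMAGES
by the typing unit (this lineage, gens 14–16).  Printed, p. 388 [PDF 34], the X_{j_h}-factor of display (1.93), verbatim:
*"· Π_{h=1}^q exp((1 + β + (3·2^d)⁻¹β)κM^{−d}|X_{j_h}|)"*; p. 389 [PDF 35], verbatim: *"The product over h there is estimated by
Π_{h=1}^q exp 2κ(100R_k)^d, and this product is combined with the first product on the right-hand side of (1.92). We assume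
that g_k is so small that −2(1+β₀)⁻¹p₀(g_k) + 1 + 2κ(100R_k)^d ≦ −(3/2)p₀(g_k)"*.  The Bałaban papers are manuscripts UNDER
ADJUDICATION by the audit cell `pub-balaban`: NOTHING printed in them is asserted here.  In the cell's typed bookkeeping
`…B16Ineq197` (unit b02, gen 14; tree v1.1) this step is the quoted LEAF `Polymer.XBudget : ∀ j ∈ cand, (1+β)κ·treeX j +
lam·βκ·vol j ≤ E` (treeX j = the tree cost of X_j WITH its entry connector — the reading under which `Subadd193` charges the
X_j-junctions to treeX, cell S-B16.12 / C-adv6-51 (3); vol j = M^{−d}|X_j|; E = the per-component exponent, print 2κ(100R_k)^d,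
entering the budget clause of `Consts.Small`, cell S-B16.13).  This module proves it under NAMED HYPOTHESES (binders): a
cardinality proxy `N j` with `treeX j ≤ N j + 1`, `vol j ≤ N j`, `N j ≤ V` — in pv22's model N j = #X_j (number of M-cubes of
X_j), the first inequality being the KERNEL fact `treeLen X_j + 2 ≤ #X_j + 1` for the consistent choice `treeX j = treeLen X_j
+ 2` of `B16Ineq197RelGlue.subadd193_of_relGlue` — and the explicit clause `(1+β)κ(V+1) + lam·βκ·V ≤ E`.  The volume bound
`#X_j ≤ V` itself (the geometry of the class-1 components, pp. 385–387: *"contained in a cube of the size 64MR_{n₀+1}"*,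
p. 385, render p031 read as image) is NOT proved here — it is the binder `hV`; the print's numbers are only shown CONSISTENT:
with β(1 + lam) ≤ ½ and V ≥ 2 + 2β the clause follows from `2κV ≤ E` (`clause_of_two_mul_le`), in particular for V = (100R)^d,
R ≥ 1, d ≥ 1 and E ≥ 2κ(100R)^d (`xBudget_printed`).

WHAT IS PROVED (no `sorry`, no new axioms; [folklore] = elementary arithmetic): `budget_le` (the monotone arithmetic),
`xBudget_of_card : … → P.XBudget K` (abstract proxy N), `xBudget_of_treeLen` (pv22's model: X_j non-empty face-connected cube
families `comp j`, `treeX j ≤ treeLen (comp j) + 2`, `vol j ≤ #(comp j) ≤ V`), `clause_of_two_mul_le` and `xBudget_printed`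
(the printed numbers), and the non-vacuity witness `Toy.toy_xBudget` (one one-cube component in ℤ¹, β = lam = 0, κ = 1, E = 4)
obtained THROUGH `xBudget_of_treeLen`.  NOT PROVED ∕ open at the lattice level (joiner): the volume bound of the class-1
components on a typed carrier of the 𝐑-operation (pp. 385–387); the place of E in the budget −2(1+β₀)⁻¹p₀ + s + E ≤ −(3/2)p₀
is the census's (`Consts.Small`, S-B16.13), untouched here.  Value: the last abstract leaf of the (1.91) ⇒ (1.97) bookkeeping
gets its (arithmetic) lattice instance — a kernel certificate of CONSISTENCY of the typed constants, explicitly LOW difficulty;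
NOT summit progress; NOT continuum; NOT Clay.  Cell records: GAPS.md C-b02g16-2; HOME/HANDOFF.md (b02 lineage, gen 16).
Naming: `B16Ineq197.Consts` ∕ `B16Ineq197.Polymer` written QUALIFIED (cf. `B16Ineq197` header note N1).  Imports
`…B16Ineq197RelGlue` only; modifies nothing.
-/

namespace Literature.MathematicalPhysics.QuantumFieldTheory.Balaban1983to89.B16Ineq197XBudget

open Literature.MathematicalPhysics.QuantumFieldTheory.Balaban1983to89
open Literature.MathematicalPhysics.QuantumFieldTheory.Balaban1983to89.B13ScaleTransfer
open Literature.MathematicalPhysics.QuantumFieldTheory.Balaban1983to89.TreeLength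
open Literature.MathematicalPhysics.QuantumFieldTheory.Balaban1983to89.B16Ineq197RelGlue

noncomputable section

variable {d : ℕ}

/-! ## §1. The arithmetic of the per-component budget -/

/-- THE MONOTONE ARITHMETIC: with β, κ, lam ≥ 0, `t ≤ N + 1`, `v ≤ N`, `N ≤ V` and the clause `(1+β)κ(V+1) + lam·βκ·V ≤ E`,
one has `(1+β)κ·t + lam·βκ·v ≤ E`. [folklore] -/
theorem budget_le {β κ lam E t v N V : ℝ} (hβ : 0 ≤ β) (hκ : 0 ≤ κ) (hlam : 0 ≤ lam) (ht : t ≤ N + 1) (hv : v ≤ N)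
    (hN : N ≤ V) (hE : (1 + β) * κ * (V + 1) + lam * β * κ * V ≤ E) : (1 + β) * κ * t + lam * β * κ * v ≤ E := by
  have h1 : 0 ≤ (1 + β) * κ := mul_nonneg (by linarith) hκ
  have h2 : 0 ≤ lam * β * κ := mul_nonneg (mul_nonneg hlam hβ) hκ
  have h3 : (1 + β) * κ * t ≤ (1 + β) * κ * (V + 1) := mul_le_mul_of_nonneg_left (by linarith) h1
  have h4 : lam * β * κ * v ≤ lam * β * κ * V := mul_le_mul_of_nonneg_left (by linarith) h2
  linarith

/-- **The leaf `XBudget` from a cardinality proxy** (binders): for every candidate component j a number `N j` with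
`treeX j ≤ N j + 1`, `vol j ≤ N j`, `N j ≤ V`, constants β, κ, lam ≥ 0 and the clause `(1+β)κ(V+1) + lam·βκ·V ≤ E` give
`P.XBudget K`. [cite: Balaban1989LargeFieldII, p.389] -/
theorem xBudget_of_card {LF DomY : Type*} (P : B16Ineq197.Polymer LF DomY) (K : B16Ineq197.Consts) (N : LF → ℝ) (V : ℝ)
    (htreeX : ∀ j ∈ P.cand, P.treeX j ≤ N j + 1) (hvol : ∀ j ∈ P.cand, P.vol j ≤ N j) (hN : ∀ j ∈ P.cand, N j ≤ V)
    (hβ : 0 ≤ K.β) (hκ : 0 ≤ K.κ) (hlam : 0 ≤ K.lam) (hE : (1 + K.β) * K.κ * (V + 1) + K.lam * K.β * K.κ * V ≤ K.E) :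
    P.XBudget K := by
  intro j hj
  exact budget_le hβ hκ hlam (htreeX j hj) (hvol j hj) (hN j hj) hE

/-- **The leaf `XBudget` in pv22's continuum model**: the candidate components are non-empty face-connected families
`comp j` of unit cubes of ℤ^d, the tree cost is charged as `treeX j ≤ treeLen (comp j) + 2` (tree + entry connector — the
consistent choice of `B16Ineq197RelGlue.subadd193_of_relGlue`, which needs `treeLen (comp j) + 2 ≤ treeX j`), the volume as
`vol j ≤ #(comp j)`, and the NAMED volume bound `#(comp j) ≤ V`; then the clause `(1+β)κ(V+1) + lam·βκ·V ≤ E` gives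
`P.XBudget K` — via the kernel fact `treeLen X + 2 ≤ #X + 1` (`treeLen_add_two_le_card_add_one`, from pv22's
`treeLen_le_card_sub_one`). [cite: Balaban1989LargeFieldII, p.389] -/
theorem xBudget_of_treeLen {LF DomY : Type*} (P : B16Ineq197.Polymer LF DomY) (K : B16Ineq197.Consts)
    (comp : LF → Finset (Pt d)) (V : ℝ) (hcomp : ∀ j ∈ P.cand, (comp j).Nonempty ∧ FaceConnected (comp j))
    (htreeX : ∀ j ∈ P.cand, P.treeX j ≤ treeLen (comp j) + 2) (hvol : ∀ j ∈ P.cand, P.vol j ≤ (comp j).card)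
    (hV : ∀ j ∈ P.cand, ((comp j).card : ℝ) ≤ V) (hβ : 0 ≤ K.β) (hκ : 0 ≤ K.κ) (hlam : 0 ≤ K.lam)
    (hE : (1 + K.β) * K.κ * (V + 1) + K.lam * K.β * K.κ * V ≤ K.E) : P.XBudget K :=
  xBudget_of_card P K (fun j => ((comp j).card : ℝ)) V
    (fun j hj => (htreeX j hj).trans (treeLen_add_two_le_card_add_one (hcomp j hj).1 (hcomp j hj).2))
    hvol hV hβ hκ hlam hE

/-! ## §2. The printed numbers are consistent with the clause -/

/-- THE CLAUSE FROM `2κV ≤ E`: if β, κ ≥ 0, `β(1 + lam) ≤ ½` and `2 + 2β ≤ V`, then `2κV ≤ E` implies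
`(1+β)κ(V+1) + lam·βκ·V ≤ E` (since (1+β)(V+1) + lam·β·V = V + 1 + β + β(1+lam)V ≤ (3/2)V + 1 + β ≤ 2V). [folklore] -/
theorem clause_of_two_mul_le {β κ lam E V : ℝ} (hβ : 0 ≤ β) (hκ : 0 ≤ κ) (hβlam : β * (1 + lam) ≤ 1 / 2)
    (hV : 2 + 2 * β ≤ V) (hE : 2 * κ * V ≤ E) : (1 + β) * κ * (V + 1) + lam * β * κ * V ≤ E := by
  have hV0 : 0 ≤ V := by linarith
  have h1 : β * (1 + lam) * V ≤ 1 / 2 * V := mul_le_mul_of_nonneg_right hβlam hV0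
  have h2 : (1 + β) * (V + 1) + lam * β * V ≤ 2 * V := by
    have : (1 + β) * (V + 1) + lam * β * V = V + 1 + β + β * (1 + lam) * V := by ring
    linarith
  calc (1 + β) * κ * (V + 1) + lam * β * κ * V = κ * ((1 + β) * (V + 1) + lam * β * V) := by ring
    _ ≤ κ * (2 * V) := mul_le_mul_of_nonneg_left h2 hκ
    _ = 2 * κ * V := by ring
    _ ≤ E := hE

/-- **`XBudget` with the printed numbers**: volume bound `#(comp j) ≤ (100R)^d` with R ≥ 1 and d ≥ 1, per-component exponent
`E ≥ 2κ(100R)^d` (print: *"estimated by Π_{h=1}^q exp 2κ(100R_k)^d"*), and `β(1 + lam) ≤ ½` (β small; print lam =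
(3·2^d)⁻¹).  The volume bound is a BINDER (class-1 geometry, pp. 385–387), not asserted. [cite: Balaban1989LargeFieldII, p.389] -/
theorem xBudget_printed {LF DomY : Type*} (P : B16Ineq197.Polymer LF DomY) (K : B16Ineq197.Consts)
    (comp : LF → Finset (Pt d)) (R : ℝ) (hR : 1 ≤ R) (hd : 1 ≤ d)
    (hcomp : ∀ j ∈ P.cand, (comp j).Nonempty ∧ FaceConnected (comp j))
    (htreeX : ∀ j ∈ P.cand, P.treeX j ≤ treeLen (comp j) + 2) (hvol : ∀ j ∈ P.cand, P.vol j ≤ (comp j).card)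
    (hV : ∀ j ∈ P.cand, ((comp j).card : ℝ) ≤ (100 * R) ^ d) (hβ : 0 ≤ K.β) (hκ : 0 ≤ K.κ) (hlam : 0 ≤ K.lam)
    (hβlam : K.β * (1 + K.lam) ≤ 1 / 2) (hE : 2 * K.κ * (100 * R) ^ d ≤ K.E) : P.XBudget K := by
  refine xBudget_of_treeLen P K comp ((100 * R) ^ d) hcomp htreeX hvol hV hβ hκ hlam
    (clause_of_two_mul_le hβ hκ hβlam ?_ hE)
  have hβhalf : K.β ≤ 1 / 2 := by
    have : K.β * (1 + K.lam) = K.β + K.β * K.lam := by ring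
    linarith [mul_nonneg hβ hlam]
  have h100 : (100 : ℝ) * R ≤ (100 * R) ^ d := by
    calc (100 : ℝ) * R = (100 * R) ^ 1 := (pow_one _).symm
      _ ≤ (100 * R) ^ d := pow_le_pow_right₀ (by linarith) hd
  linarith

/-! ## §3. Non-vacuity: one one-cube component -/

namespace Toy

/-- The toy polymer with ONE candidate component (index `()`), no localization domains, one admissible term ({()}, ∅);
tree cost treeX = 2 (= treeLen of one cube + 2), volume vol = 1. [folklore] -/
def toyP1 : B16Ineq197.Polymer Unit Unit where
  cand := Finset.univ
  Ycat := ∅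
  adm := {(Finset.univ, ∅)}
  dX := 0
  v := 0
  dY := fun _ => 0
  treeX := fun _ => 2
  vol := fun _ => 1
  adm_fst := fun _ _ => Finset.subset_univ _
  adm_snd := fun p hp => by rw [Finset.mem_singleton.1 hp]
  v_nonneg := le_rfl
  dY_nonneg := fun _ _ => le_rfl

/-- Toy constants: β = lam = 0, κ = 1, E = 4, everything else 0. [folklore] -/
def toyK1 : B16Ineq197.Consts where
  α := 0
  β := 0
  κ := 1
  p0 := 0
  β₀ := 0
  s := 0
  E := 4
  lam := 0
  a₁ := 0
  a₀ := 0
  cJ := 0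
  C₁ := 0
  ρ := 0

/-- **Non-vacuity of `xBudget_of_treeLen`**: the component is the single cube `tpt false` of ℤ¹ (non-empty, face-connected,
treeLen = 0), V = 1, and the clause reads (1+0)·1·(1+1) + 0 ≤ 4; the conclusion is the toy polymer's `XBudget`. [folklore] -/
theorem toy_xBudget : toyP1.XBudget toyK1 := by
  refine xBudget_of_treeLen (d := 1) toyP1 toyK1 (fun _ => {B16Ineq197RelGlue.Toy.tpt false}) 1 ?_ ?_ ?_ ?_ (by norm_num [toyK1])
    (by norm_num [toyK1]) (by norm_num [toyK1]) (by norm_num [toyK1])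
  · intro j _
    refine ⟨Finset.singleton_nonempty _, ?_⟩
    intro a ha b hb
    rw [Finset.mem_singleton] at ha hb
    subst ha; subst hb
    exact Relation.ReflTransGen.refl
  · intro j _
    show (2 : ℝ) ≤ treeLen ({B16Ineq197RelGlue.Toy.tpt false} : Finset (Pt 1)) + 2
    rw [treeLen_singleton]; norm_num
  · intro j _
    show (1 : ℝ) ≤ (({B16Ineq197RelGlue.Toy.tpt false} : Finset (Pt 1)).card : ℝ)
    simp
  · intro j _
    simp

end Toy

end

end Literature.MathematicalPhysics.QuantumFieldTheory.Balaban1983to89.B16Ineq197XBudget
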